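import Summits.FinalStateConjecture.FinalStateConjecture.Statement

/-!
# Route StarvedNecks — crux `SeamedChartsExhaust`, line `wide-anchoring` (generation 2): stub `stub_rim`

The RIM ENUMERATION (the COVER half of the line; no causal content — closure bookkeeping over the
chart images of an `N`-black-hole final-state decomposition `d`). Every point of `O` in the closure
of the certified late region `F = certifiedLate d R τ₁` but not in `F` lies on the certified slab
`certifiedSlab d R τ₁` or is a ride-able certified tube point `Ψⱼ x` of some hole `j`
(`(τ₀ ≤ tⱼ ∨ τ₀ ≤ x⁰) ∧ R₀ ≤ rⱼ ≤ Rⱼ(tⱼ) ∧ tⱼ ≤ τ₁`).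

Enumeration: `closure F = closure F₀ ∪ ⋃ⱼ closure Fⱼ` (finite union), with
`F₀ = Φ '' {τ₁ < y⁰}` and `Fⱼ = Ψⱼ '' {τ₁ < tⱼ, rⱼ ≤ Rⱼ(tⱼ)}`.

* `closure F₀ ⊆ closure Φ '' {τ₁ ≤ y⁰} ⊆` [SEAMED (11) at `τ' := τ₁`] flat points with `y⁰ ≥ τ₁`
  (`> τ₁`: in `F`, excluded; `= τ₁`: flat slab) or flat-tube WALL points `Ψⱼ x`, `x⁰ ≥ τ₁`,
  `rⱼ x = ρⱼ(x⁰) ≥ R₀` [SEAMED (1)], `rⱼ + 2 ≤ Rⱼ(tⱼ x)` [SEAMED (8)] (`tⱼ x > τ₁`: in `Fⱼ`, excluded;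
  else ride-able through the flat-late disjunct `τ₀ ≤ x⁰`).
* `closure Fⱼ ∩ O ⊆` [HonestCore (c) with the continuous profile `ϱ := Rⱼ`, `τ' := τ₁`]
  `Ψⱼ '' {τ₁ ≤ t, r ≤ Rⱼ(t)}` (`t > τ₁`: in `Fⱼ`, excluded; `t = τ₁`: hole disc of the certified slab).

Clauses consumed: HonestCore (c) = `hcl`, SEAMED (1) = `h1`, (8) = `h8`, (11) = `h11`.
Mathlib only (`closure_union`, `closure_iUnion_of_finite`, `closure_mono`); no named facts.

References: B. O'Neill, *Semi-Riemannian geometry*, Academic Press 1983, Ch. 14, p. 403;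
E. Minguzzi, Living Rev. Relativ. 22 (2019) 3 = arXiv:1709.06494, §2;
M. Dafermos, G. Holzegel, I. Rodnianski, M. Taylor, arXiv:2104.08222, §1 (late-time charts).
-/

noncomputable section

set_option linter.dupNamespace false

open Set Filter Topology Function TopologicalSpace
open scoped Manifold ContDiff ENNReal Topology
open Literature.Geometry.Lorentzian

namespace Summit.FinalStateConjecture.FinalStateConjecture.Theorems.SeamedChartsExhaust.WideAnchoring

/-- **RIM ENUMERATION** (stub `stub_rim` of line `wide-anchoring`, generation 2; the COVER half, no
causal content). Every point of `O` in the closure of the certified late region after `τ₁` but not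
in it lies on the certified slab at `τ₁` or is a ride-able certified tube point of some hole `j`
(hole time `≤ τ₁`, `R₀ ≤ rⱼ ≤ Rⱼ(tⱼ)`, hole-late or flat-late). Enumeration: `closure F =
closure F₀ ∪ ⋃ⱼ closure Fⱼ` (finite union); `closure F₀ ⊆ closure Φ''{τ₁ ≤ y⁰} ⊆` [SEAMED (11) at
`τ' := τ₁`] flat points with `y⁰ ≥ τ₁` (`> τ₁`: in `F`; `= τ₁`: flat slab) or flat-tube WALL points
`Ψⱼ x`, `x⁰ ≥ τ₁`, `rⱼ x = ρⱼ(x⁰) ≥ R₀` [SEAMED (1)], `rⱼ + 2 ≤ Rⱼ(tⱼ x)` [SEAMED (8)]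
(`tⱼ x > τ₁`: in `Fⱼ`, excluded; else ride-able through the flat-late disjunct `τ₀ ≤ x⁰`);
`closure Fⱼ ∩ O ⊆` [HonestCore (c) with the continuous profile `ϱ := Rⱼ`, `τ' := τ₁`]
`Ψⱼ''{τ₁ ≤ t, r ≤ Rⱼ(t)}` (`t > τ₁`: in `Fⱼ`; `t = τ₁`: hole disc). Clauses: Hc (c) = `hcl`,
SEAMED (1) = `h1`, (8) = `h8`, (11) = `h11`. O'Neill 1983, Ch. 14, p. 403; Minguzzi,
arXiv:1709.06494, §2. [folklore] -/
theorem stub_rim (𝓢 : Spacetime.{0} 4) (O : Set 𝓢.carrier) (d : FinalStateDecomposition 𝓢 O 2)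
    (R : Fin d.N → ℝ → ℝ) (R₀ : ℝ)
    (hcl : ∀ i (τ' : ℝ) (ϱ : ℝ → ℝ), Continuous ϱ → d.τ₀ < τ' →
      closure (d.chart i '' {x | τ' ≤ (d.background i).time x.1 ∧
        (d.background i).radius x.1 ≤ ϱ ((d.background i).time x.1)}) ∩ O ⊆
      d.chart i '' {x | τ' ≤ (d.background i).time x.1 ∧
        (d.background i).radius x.1 ≤ ϱ ((d.background i).time x.1)})
    (h1 : ∀ i, Continuous (R i) ∧ ∀ s, R₀ ≤ d.excision i s)
    (h8 : ∀ j (y : E4), d.τ₀ ≤ y 0 → (d.background j).radius y ≤ d.excision j (y 0) →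
      (d.background j).radius y + 2 ≤ R j ((d.background j).time y))
    (h11 : ∀ τ' : ℝ, d.τ₀ < τ' → closure (d.flatChart '' {y | τ' ≤ y.1 0}) ⊆
      d.flatChart '' {y | τ' ≤ y.1 0} ∪
        ⋃ j, d.chart j '' {x | τ' ≤ x.1 0 ∧ (d.background j).radius x.1 = d.excision j (x.1 0)})
    (τ₁ : ℝ) (hτ₁ : d.τ₀ < τ₁) :
    (closure (certifiedLate d R τ₁) ∩ O) \ certifiedLate d R τ₁ ⊆
      certifiedSlab d R τ₁ ∪ ⋃ j, d.chart j '' {x | (d.τ₀ ≤ (d.background j).time x.1 ∨ d.τ₀ ≤ x.1 0) ∧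
        R₀ ≤ (d.background j).radius x.1 ∧
        (d.background j).radius x.1 ≤ R j ((d.background j).time x.1) ∧
        (d.background j).time x.1 ≤ τ₁} := by
  rintro z ⟨⟨hzcl, hzO⟩, hzF⟩
  -- `closure (F₀ ∪ ⋃ⱼ Fⱼ) = closure F₀ ∪ ⋃ⱼ closure Fⱼ` (finitely many holes)
  rw [certifiedLate, closure_union, closure_iUnion_of_finite] at hzcl
  rcases hzcl with hz0 | hzj
  · -- Case A: `z ∈ closure F₀ ⊆ closure Φ''{τ₁ ≤ y⁰}`, enumerated by SEAMED (11)
    have hsub : d.flatChart '' (Minkowski.backgroundOn d.flatDomain).lateRegion τ₁ ⊆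
        d.flatChart '' {y | τ₁ ≤ y.1 0} := by
      rintro _ ⟨y, hy, rfl⟩
      exact ⟨y, le_of_lt (show τ₁ < y.1 0 from hy), rfl⟩
    rcases h11 τ₁ hτ₁ (closure_mono hsub hz0) with h | h
    · -- (A1) a flat point with `y⁰ ≥ τ₁`
      obtain ⟨y, hy, rfl⟩ := h
      rcases (show τ₁ ≤ y.1 0 from hy).eq_or_lt with h | h
      · exact Or.inl (Or.inl ⟨y, h.symm, rfl⟩)
      · exact (hzF (Or.inl ⟨y, h, rfl⟩)).elim
    · -- (A2) a flat-tube wall point `Ψⱼ x`, `x⁰ ≥ τ₁`, `rⱼ x = ρⱼ(x⁰)`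
      obtain ⟨j, x, ⟨hx0, hwall⟩, rfl⟩ := Set.mem_iUnion.mp h
      have hτ₀x : d.τ₀ ≤ x.1 0 := le_of_lt (lt_of_lt_of_le hτ₁ hx0)
      have h8x := h8 j x.1 hτ₀x hwall.le
      have hrR : (d.background j).radius x.1 ≤ R j ((d.background j).time x.1) := by linarith
      have hR₀ : R₀ ≤ (d.background j).radius x.1 := ((h1 j).2 (x.1 0)).trans_eq hwall.symm
      by_cases ht : (d.background j).time x.1 ≤ τ₁
      · exact Or.inr (Set.mem_iUnion.mpr ⟨j, x, ⟨Or.inr hτ₀x, hR₀, hrR, ht⟩, rfl⟩)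
      · exact (hzF (Or.inr (Set.mem_iUnion.mpr ⟨j, x, ⟨lt_of_not_ge ht, hrR⟩, rfl⟩))).elim
  · -- Case B: `z ∈ closure Fⱼ ∩ O ⊆ Ψⱼ''{τ₁ ≤ t, r ≤ Rⱼ(t)}` by HonestCore (c)
    obtain ⟨j, hj⟩ := Set.mem_iUnion.mp hzj
    have hsub : d.chart j '' {x | τ₁ < (d.background j).time x.1 ∧
          (d.background j).radius x.1 ≤ R j ((d.background j).time x.1)} ⊆
        d.chart j '' {x | τ₁ ≤ (d.background j).time x.1 ∧
          (d.background j).radius x.1 ≤ R j ((d.background j).time x.1)} :=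
      Set.image_mono fun x hx ↦ ⟨le_of_lt hx.1, hx.2⟩
    obtain ⟨x, ⟨hxt, hxr⟩, rfl⟩ := hcl j τ₁ (R j) (h1 j).1 hτ₁ ⟨closure_mono hsub hj, hzO⟩
    rcases hxt.eq_or_lt with h | h
    · exact Or.inl (Or.inr (Set.mem_iUnion.mpr ⟨j, x, ⟨h.symm, h ▸ hxr⟩, rfl⟩))
    · exact (hzF (Or.inr (Set.mem_iUnion.mpr ⟨j, x, ⟨h, hxr⟩, rfl⟩))).elim

end Summit.FinalStateConjecture.FinalStateConjecture.Theorems.SeamedChartsExhaust.WideAnchoring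

end
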